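import Summits.QuantumFields.QCD.Theorems.GapBuysCauchyRateRotationRestorationDefs
import Literature.MathematicalPhysics.QuantumFieldTheory.SchwingerLimitInheritance
import Literature.MathematicalPhysics.QuantumLattice.SchwartzTensorDensity
import HarnessLib

/-!
# Stub `stub_latticeInvariancePassesToLimit : LatticeInvariancePassesToLimit` (S1b of line `registered`,
reshape r1, crux stmt-QuantumFields-8840 `RotationRestoration`) — PROVED

An exact lattice symmetry of the scheme passes to every tied limit, on separated tensors: if the linear
isometry `A` of `ℝ⁴` leaves every lattice `n`-point function `qcdLatticeSchwinger sch k n σ ·` invariant at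
every cutoff `k` under `fᵢ ↦ fᵢ ∘ A⁻¹` (`linActTest A`), then every Schwinger family `S` tied to `sch`
(`IsLatticeLimit sch S`) satisfies `S n σ (F ∘ A⁻¹) = S n σ F` (`linActMulti A F`) for every separated real
tensor `F = f₁ ⊗ ⋯ ⊗ fₙ` (`IsSeparated f`, `IsTensorOf F (ofRealTest ∘ f)`).

Proof (soft; pure bookkeeping of limits, no lattice input beyond the hypotheses):
* `n = 0`: `(Fin 0 → ℝ⁴)` is a point, so `linActMulti A F = F`;
* `n ≠ 0`: `F ∘ A⁻¹` is the tensor of the `fᵢ ∘ A⁻¹` (`isTensorOf_linActMulti_ofRealTest`, pointwise); a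
  separated tensor is off-diagonal (`isOffDiagonal_of_isSeparated`: a point `x` of `tsupport F` has
  `xᵢ ∈ tsupport fᵢ` for all `i` by `IsTensorOf.tsupport_subset`, and the supports are pairwise disjoint, so
  `tsupport F` avoids the coincidence locus, `IsOffDiagonal.of_tsupport_subset`), and `⁰𝒮` is stable under
  the diagonal action of `A` (`IsOffDiagonal.precomp`); the tie then exhibits `S n σ (F ∘ A⁻¹)` and `S n σ F`
  as the limits of the lattice sequences `k ↦ ⟨∏ Φ^{σᵢ}(fᵢ ∘ A⁻¹)⟩_k` and `k ↦ ⟨∏ Φ^{σᵢ}(fᵢ)⟩_k`, which agree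
  termwise by the invariance hypothesis; limits in `ℂ` are unique (`tendsto_nhds_unique`).

References: Osterwalder–Schrader 1973 §2 (`⁰𝒮`, Euclidean action on test functions); Osterwalder–Schrader
1975 §4 / Glimm–Jaffe 1987 §6.1 (inheritance of exact symmetries by limits of Schwinger functions).
-/

noncomputable section

namespace Summit.QuantumFields.QCD.Cruxes.RotationRestoration.Birth

open scoped BigOperators Topology SchwartzMap
open Filter
open Literature.MathematicalPhysics.QuantumLattice Literature.MathematicalPhysics.AQFT
  Literature.MathematicalPhysics.QuantumFieldTheory

namespace LatticeInvariancePassesToLimit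

variable {E : Type*} [NormedAddCommGroup E] [NormedSpace ℝ E] {n : ℕ}

/-- `⁰𝒮` is stable under the diagonal action of a linear isometry (a linear change of variables
preserving the diagonals; `IsOffDiagonal.precomp`). [folklore] -/
theorem isOffDiagonal_linActMulti (A : E ≃ₗᵢ[ℝ] E) {F : 𝓢((Fin n → E), ℂ)} (hF : IsOffDiagonal F) :
    IsOffDiagonal (linActMulti A F) :=
  hF.precomp
    (ContinuousLinearEquiv.piCongrRight fun _ : Fin n => A.symm.toContinuousLinearEquiv)
    (fun x hx => by
      obtain ⟨i, j, hij, hxij⟩ := hx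
      exact ⟨i, j, hij, by simp [hxij]⟩)
    (fun _ => rfl)

/-- The diagonal action of a linear isometry on a complexified real tensor product is the tensor product
of the transformed factors: `(f₁ ⊗ ⋯ ⊗ fₙ) ∘ A⁻¹ = (f₁ ∘ A⁻¹) ⊗ ⋯ ⊗ (fₙ ∘ A⁻¹)` (pointwise). [folklore] -/
theorem isTensorOf_linActMulti_ofRealTest (A : E ≃ₗᵢ[ℝ] E) {F : 𝓢((Fin n → E), ℂ)}
    {f : Fin n → 𝓢(E, ℝ)} (hF : IsTensorOf F (fun i => ofRealTest (f i))) :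
    IsTensorOf (linActMulti A F) (fun i => ofRealTest (linActTest (𝕜 := ℝ) A (f i))) := by
  intro x
  rw [linActMulti_apply, hF]
  rfl

/-- In arity `0` the diagonal action is trivial: `(Fin 0 → E)` is a single point. [folklore] -/
theorem linActMulti_fin_zero (A : E ≃ₗᵢ[ℝ] E) (F : 𝓢((Fin 0 → E), ℂ)) : linActMulti A F = F := by
  ext x
  rw [linActMulti_apply]
  congr 1
  funext i
  exact Fin.elim0 i

/-- **A separated real tensor is off-diagonal.**  If `F = f₁ ⊗ ⋯ ⊗ fₙ` (complexified) with pairwise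
disjoint `tsupport fᵢ`, then `tsupport F` avoids the coincidence locus — a point `x` of `tsupport F` has
`xᵢ ∈ tsupport fᵢ` for every `i` (`IsTensorOf.tsupport_subset`), so `xᵢ = xⱼ` with `i ≠ j` would lie in two
disjoint supports — whence `F ∈ ⁰𝒮` by the support criterion `IsOffDiagonal.of_tsupport_subset`. [folklore] -/
theorem isOffDiagonal_of_isSeparated {f : Fin n → 𝓢(EuclideanSpace ℝ (Fin 4), ℝ)} (hf : IsSeparated f)
    {F : 𝓢((Fin n → EuclideanSpace ℝ (Fin 4)), ℂ)} (hF : IsTensorOf F (fun i => ofRealTest (f i))) :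
    IsOffDiagonal F := by
  refine IsOffDiagonal.of_tsupport_subset fun x hx hxc => ?_
  obtain ⟨i, j, hij, hxij⟩ := hxc
  have hi : x i ∈ tsupport (f i : EuclideanSpace ℝ (Fin 4) → ℝ) :=
    tsupport_comp_subset (g := fun t : ℝ => (t : ℂ)) Complex.ofReal_zero _ (hF.tsupport_subset hx i)
  have hj : x j ∈ tsupport (f j : EuclideanSpace ℝ (Fin 4) → ℝ) :=
    tsupport_comp_subset (g := fun t : ℝ => (t : ℂ)) Complex.ofReal_zero _ (hF.tsupport_subset hx j)
  rw [hxij] at hi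
  exact Set.disjoint_left.1 (hf.2 i j hij) hi hj

end LatticeInvariancePassesToLimit

/-- **Registered stub `stub_latticeInvariancePassesToLimit` (S1b) — an exact lattice symmetry of the
scheme passes to every tied limit, on separated tensors (PROVED).**  For `n = 0` the action is trivial
(`linActMulti_fin_zero`); for `n ≠ 0` both `S n σ (F ∘ A⁻¹)` and `S n σ F` are limits (the tie, applied to the
off-diagonal tensors `F ∘ A⁻¹ = ⊗ (fᵢ ∘ A⁻¹)` and `F = ⊗ fᵢ`) of lattice sequences that agree termwise by the
exact invariance hypothesis, and limits in `ℂ` are unique. -/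
theorem stub_latticeInvariancePassesToLimit : LatticeInvariancePassesToLimit := by
  intro Nf sch S hS A hA n σ f hf F hF
  rcases Nat.eq_zero_or_pos n with rfl | hn
  · rw [LatticeInvariancePassesToLimit.linActMulti_fin_zero]
  · have hF' : IsTensorOf (linActMulti A F) (fun i => ofRealTest (linActTest (𝕜 := ℝ) A (f i))) :=
      LatticeInvariancePassesToLimit.isTensorOf_linActMulti_ofRealTest A hF
    have hoff : IsOffDiagonal F := LatticeInvariancePassesToLimit.isOffDiagonal_of_isSeparated hf hF
    have hoff' : IsOffDiagonal (linActMulti A F) :=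
      LatticeInvariancePassesToLimit.isOffDiagonal_linActMulti A hoff
    have h₁ : Tendsto (fun k : ℕ => qcdLatticeSchwinger sch k n σ f) atTop (𝓝 (S n σ (linActMulti A F))) :=
      (hS n hn.ne' σ (fun i => linActTest (𝕜 := ℝ) A (f i)) (linActMulti A F) hF' hoff').congr
        fun k => hA k n σ f
    have h₂ : Tendsto (fun k : ℕ => qcdLatticeSchwinger sch k n σ f) atTop (𝓝 (S n σ F)) :=
      hS n hn.ne' σ f F hF hoff
    exact tendsto_nhds_unique h₁ h₂

end Summit.QuantumFields.QCD.Cruxes.RotationRestoration.Birth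

end
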